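import Summits.AtomisticToContinuum.HydrodynamicLimit.Theorems.BoxDissipativeWeakStrongEntropyAdmissibilityStubConcentrationOfPTBC

/-!
# Crux `EntropyAdmissibility` (stmt-AtomisticToContinuum-9903), line `registered` — stub `stub_entropyBalanceConcentration_of_PTBCInBand`

Reshape r6 of the line (continuation lead c1, on worker S2a's audit, evidence `S2a-audit.md` §3(ii)): the open fluctuation
stub S2a is WEAKENED to its in-band form S2a' = `stub_positiveTimeBoxConcentrationInBand` — the positive-time box
concentration of linear-growth Borel functionals is now asked only in the crux's OWN frame (EOS fact, band `η₁ < η_c`,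
packing guard `ρσ³ ≤ η₁/2` on the classical solution), exactly the instances the composition consumes, instead of for
classical solutions of the `limsup`/`deriv` equation of state at all densities reached before `T`. This file is S2b' :
**S2a' → S2** (`Sig.stub_entropyBalanceConcentration` unchanged). The proof is that of the landed S2b
(`EABirthS2b.stub_entropyBalanceConcentration_of_PTBC`, p153346) verbatim up to the threshold bookkeeping
(`ηc := min η₀ ηc(S2a')`, the guard handed to S2a'); all lemmas are imported from `EABirthS2b` / `EABirthS2bA`.

References: J. Březina, E. Feireisl, J. Math. Soc. Japan 70 (2018), Def. 2.9, §3.2; H. Spohn (1991), Part I Ch. 3.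
-/

noncomputable section

open MeasureTheory Filter Set
open scoped ENNReal Topology

namespace Summit.AtomisticToContinuum.HydrodynamicLimit.Theorems.EABirthS2bG

open Literature.MathematicalPhysics.KineticTheory
open Literature.Analysis.FluidPDE.CompressibleEuler (clamp)
open Summit.AtomisticToContinuum.HydrodynamicLimit.Theses
open Summit.AtomisticToContinuum.HydrodynamicLimit.Theorems.BDWS
open Literature.Analysis.FluidPDE (Config configEnergy HardSphereFlow)
open Literature.Analysis.FunctionSpaces
open EABirthS1a (statEntropy statBulk statBdry)
open EABirthS2bA EABirthS2b

/-- Signature of the stub S2b': `Sig.stub_positiveTimeBoxConcentrationInBand → Sig.stub_entropyBalanceConcentration` of the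
lead's skeleton (r6), both bodies inlined verbatim (definitionally the skeleton's statement). The antecedent S2a' is S2a
stated in the crux's frame: EOS fact, band threshold, packing guard. -/
def Sig.stub_entropyBalanceConcentration_of_PTBCInBand : Prop :=
  (BoxDissipativeWeakStrong.HsEosLowDensity →
    ∃ ηc : ℝ, 0 < ηc ∧ ∀ η₁ : ℝ, 0 < η₁ → η₁ < ηc →
      ∀ (a₀ θ₀ : T3 → ℝ) (u₀ : T3 → V3), Continuous a₀ → Continuous θ₀ → Continuous u₀ →
        (∀ x, 0 < a₀ x) → (∀ x, 0 < θ₀ x) →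
        ∃ σ₀ : ℝ, 0 < σ₀ ∧ ∀ σ : ℝ, 0 < σ → σ < σ₀ →
          ∀ (T : ℝ) (ρ θ : ℝ → T3 → ℝ) (u : ℝ → T3 → V3), IsHardSphereEulerSolution σ T ρ u θ →
            (∀ t ∈ Ico 0 T, ∀ x, ρ t x * σ ^ 3 ≤ η₁ / 2) →
            ∀ Φ : FlowFamily σ,
              TendstoHydroFieldsAt (fun N => localGibbsLaw σ a₀ u₀ θ₀ N (Φ N)) Φ ρ u θ 0 →
              ∀ ℓ : ℕ → ℝ, (∀ N, 0 < ℓ N ∧ ℓ N ≤ 1) → Tendsto ℓ atTop (𝓝 0) →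
                Tendsto (fun N : ℕ => ℓ N ^ 3 * ((N : ℝ) + 1)) atTop atTop →
                ∀ t ∈ Ico 0 T, ∀ G : ℝ × V3 × ℝ → ℝ, Measurable G → (∀ p, |G p| ≤ |p.1| + ‖p.2.1‖) →
                  ∀ ψ : T3 → ℝ, Continuous ψ →
                    Tendsto (fun N : ℕ => ∫⁻ z, ENNReal.ofReal
                        |(∫ x, G (boxDensity σ ℓ Φ N t z x, boxMomentum σ ℓ Φ N t z x,
                            boxEnergy σ ℓ Φ N t z x) * ψ x) -
                          ∫ z', (∫ x, G (boxDensity σ ℓ Φ N t z' x, boxMomentum σ ℓ Φ N t z' x,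
                            boxEnergy σ ℓ Φ N t z' x) * ψ x) ∂(localGibbsLaw σ a₀ u₀ θ₀ N (Φ N))|
                      ∂(localGibbsLaw σ a₀ u₀ θ₀ N (Φ N))) atTop (𝓝 0)) →
      (BoxDissipativeWeakStrong.HsEosLowDensity →
    ∃ ηc : ℝ, 0 < ηc ∧ ∀ η₁ : ℝ, 0 < η₁ → η₁ < ηc →
      ∀ (a₀ θ₀ : T3 → ℝ) (u₀ : T3 → V3), Continuous a₀ → Continuous θ₀ → Continuous u₀ →
        (∀ x, 0 < a₀ x) → (∀ x, 0 < θ₀ x) →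
        ∃ σ₀ : ℝ, 0 < σ₀ ∧ ∀ σ : ℝ, 0 < σ → σ < σ₀ →
          ∀ (T : ℝ) (ρ θ : ℝ → T3 → ℝ) (u : ℝ → T3 → V3), IsHardSphereEulerSolution σ T ρ u θ →
            (∀ t ∈ Ico 0 T, ∀ x, ρ t x * σ ^ 3 ≤ η₁ / 2) →
            ∀ Φ : FlowFamily σ,
              TendstoHydroFieldsAt (fun N => localGibbsLaw σ a₀ u₀ θ₀ N (Φ N)) Φ ρ u θ 0 →
              ∀ ℓ : ℕ → ℝ, (∀ N, 0 < ℓ N ∧ ℓ N ≤ 1) → Tendsto ℓ atTop (𝓝 0) →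
                Tendsto (fun N : ℕ => ℓ N ^ 3 * ((N : ℝ) + 1)) atTop atTop →
                ∀ τ ∈ Ico 0 T, ∀ a b : ℝ, a < b → ∀ φ : ℝ → T3 → ℝ,
                  Literature.Analysis.FunctionSpaces.Torus.IsSmoothSpaceTimeOn (Ico 0 T) φ →
                  (∀ t ∈ Icc 0 τ, ∀ x, 0 ≤ φ t x) →
                  Tendsto (fun N : ℕ => ∫⁻ z, ENNReal.ofReal
                      |dynPart σ η₁ T ℓ Φ τ a b φ N z -
                        ∫ z', dynPart σ η₁ T ℓ Φ τ a b φ N z' ∂(localGibbsLaw σ a₀ u₀ θ₀ N (Φ N))|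
                    ∂(localGibbsLaw σ a₀ u₀ θ₀ N (Φ N))) atTop (𝓝 0))

/-- **Registered stub `stub_entropyBalanceConcentration_of_PTBCInBand` (S2b')** of the line `registered` of the crux
stmt-AtomisticToContinuum-9903: no anomalous entropy fluctuations (`A_N − E A_N → 0` in `L¹(P_N)`) from the IN-BAND
positive-time box concentration S2a'. Thresholds: `ηc := min η₀ ηc(S2a')`, `σ₀ := min σ₀(S2a') (1/2)`; the guard is passed
to S2a'. Proof body: the landed S2b (p153346) verbatim. -/
theorem stub_entropyBalanceConcentration_of_PTBCInBand : Sig.stub_entropyBalanceConcentration_of_PTBCInBand := by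
  intro hPTBC hEos
  obtain ⟨ηp, hηp, HP⟩ := hPTBC hEos
  obtain ⟨η₀, hη₀, F, hFan, hFeq, -⟩ := hEos
  have hcont : ContinuousOn hsExcessFreeEnergy (Ico 0 η₀) :=
    (hFan.continuousOn.mono fun η hη => ⟨(neg_lt_zero.2 hη₀).trans_le hη.1, hη.2⟩).congr hFeq
  refine ⟨min η₀ ηp, lt_min hη₀ hηp, fun η₁ hη₁ hη₁c' a₀ θ₀ u₀ ha hθ hu ha0 hθ0 => ?_⟩
  have hη₁c : η₁ < η₀ := hη₁c'.trans_le (min_le_left _ _)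
  obtain ⟨σ₁, hσ₁, H₁⟩ := HP η₁ hη₁ (hη₁c'.trans_le (min_le_right _ _)) a₀ θ₀ u₀ ha hθ hu ha0 hθ0
  refine ⟨min σ₁ (1 / 2), lt_min hσ₁ one_half_pos, ?_⟩
  intro σ hσ hσlt T ρ θ u hsol hguard Φ hLLN ℓ hℓ hℓ0 hℓ3 τ hτ a b hab φ hφ _
  have H := H₁ σ hσ (hσlt.trans_le (min_le_left _ _)) T ρ θ u hsol hguard Φ hLLN ℓ hℓ hℓ0 hℓ3
  have hP : ∀ N, IsProbabilityMeasure (localGibbsLaw σ a₀ u₀ θ₀ N (Φ N)) := fun N =>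
    isProbabilityMeasure_localGibbsLaw ha hθ hu ha0 hθ0 (hσlt.trans_le (min_le_right _ _)).le N (Φ N)
  have hgood : ∀ N, localGibbsLaw σ a₀ u₀ θ₀ N (Φ N) (Φ N).goodᶜ = 0 := fun N => by
    rw [localGibbsLaw_eq]
    exact localGibbsMeasure_absolutelyContinuous σ a₀ u₀ θ₀ N (Φ N) (Φ N).measure_compl_good
  obtain ⟨K, hK, hWK⟩ := exists_lintegral_meanKinetic_le ha hθ hu (fun x => (ha0 x).le) hθ0
  have hWK' := fun N => hWK σ N (Φ N)
  -- test data: clamped in time to `[0, τ] ⊆ [0, T)`, continuous slices, sup bounds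
  have hIcc : Icc 0 τ ⊆ Ico 0 T := fun t ht => ⟨ht.1, ht.2.trans_lt hτ.2⟩
  have hS : UniqueDiffOn ℝ (Ico 0 T) := uniqueDiffOn_Ico 0 T
  have hcl : ∀ t : ℝ, max 0 (min t τ) ∈ Icc 0 τ := fun t => ⟨le_max_left _ _, max_le hτ.1 (min_le_right _ _)⟩
  set ψ₁ : ℝ → T3 → ℝ := fun s => Torus.timeDerivWithin (Ico 0 T) φ (max 0 (min s τ)) with hψ₁
  set ψ₂ : ℝ → T3 → V3 := fun s => Torus.gradient (φ (max 0 (min s τ))) with hψ₂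
  have hψ₁c : ∀ t, Continuous (ψ₁ t) := fun t => ((hφ.timeDerivWithin hS).isSmooth_slice (hIcc (hcl t))).continuous
  have hψ₂c : ∀ t (k : Fin 3), Continuous fun x => ψ₂ t x k := fun t k =>
    (show Continuous fun m : V3 => m k by fun_prop).comp ((hφ.gradient hS).isSmooth_slice (hIcc (hcl t))).continuous
  have hφτ : Continuous (φ τ) := (hφ.isSmooth_slice (hIcc ⟨hτ.1, le_rfl⟩)).continuous
  obtain ⟨D, hD⟩ := (hφ.timeDerivWithin hS).exists_norm_le_of_isCompact isCompact_Icc hIcc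
  obtain ⟨Gs, hGs⟩ := (hφ.gradient hS).exists_norm_le_of_isCompact isCompact_Icc hIcc
  have hD0 : 0 ≤ D := (norm_nonneg _).trans (hD 0 ⟨le_rfl, hτ.1⟩ 0)
  have hGs0 : 0 ≤ Gs := (norm_nonneg _).trans (hGs 0 ⟨le_rfl, hτ.1⟩ 0)
  have hM := max_abs_pos hab
  -- the integrands
  have hZ := measurable_entG hcont hσ.le hη₁.le hη₁c a b
  have hmG := fun k => measurable_densG_momG hZ k (σ := σ) (η₁ := η₁)
  have hgr := fun k p => abs_densG_momG_le hab k p (σ := σ) (η₁ := η₁)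
  -- fixed-time concentration of the pieces along the regularised flow
  have cD : ∀ t ∈ Ico 0 T, ∀ ψ : T3 → ℝ, Continuous ψ → _ := fun t ht ψ hψ =>
    conc_gflow hP hgood hℓ hK hWK' (hmG 0).1 (fun p => (hgr 0 p).1) hψ t (H t ht _ (hmG 0).1 (fun p => (hgr 0 p).1) ψ hψ)
  have cM : ∀ t ∈ Ico 0 T, ∀ k : Fin 3, ∀ ψ : T3 → ℝ, Continuous ψ → _ := fun t ht k ψ hψ =>
    conc_gflow hP hgood hℓ hK hWK' (hmG k).2 (fun p => (hgr k p).2) hψ t (H t ht _ (hmG k).2 (fun p => (hgr k p).2) ψ hψ)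
  -- the bulk `g N t z` and the boundary `k N z`
  set g : ∀ N : ℕ, ℝ → Config (N + 1) (Fin 3) T3 → ℝ := fun N t z =>
    ∫ x, statBulk σ η₁ (ℓ N) a b ψ₁ ψ₂ t (gflow (Φ N) t z) x with hg
  have hg_eq : ∀ N t z, g N t z = max |a| |b| * (∫ x, densG σ η₁ a b (fields (ℓ N) (gflow (Φ N) t z) x) * ψ₁ t x) +
      ∑ k, max |a| |b| * ∫ x, momG σ η₁ a b k (fields (ℓ N) (gflow (Φ N) t z) x) * ψ₂ t x k := fun N t z => by
    have h1 := integrable_growth (hmG 0).1 (fun p => (hgr 0 p).1) (hψ₁c t) (hℓ N).1.le (gflow (Φ N) t z)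
    have h2 := fun k => integrable_growth (hmG k).2 (fun p => (hgr k p).2) (hψ₂c t k) (hℓ N).1.le (gflow (Φ N) t z)
    simp only [hg, statBulk_eq hab (hℓ N).1.le (σ := σ) (η₁ := η₁)]
    rw [integral_add (h1.const_mul _) (integrable_finsetSum _ fun k _ => (h2 k).const_mul _), integral_const_mul,
      integral_finsetSum _ fun k _ => (h2 k).const_mul _]
    simp only [integral_const_mul]
  -- `N`-uniform affine bound on the bulk
  have hbd : ∀ N t z, |g N t z| ≤ 3 / 2 * (max |a| |b| * D + 3 * (max |a| |b| * Gs)) +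
      (max |a| |b| * D + 3 * (max |a| |b| * Gs)) / 2 * (((N : ℝ) + 1)⁻¹ * ∑ i, ‖(z i).2‖ ^ 2) := fun N t z => by
    rw [hg_eq, ← sum_norm_sq_gflow (Φ N) t z]
    have e1 := abs_integral_growth_le (hℓ N).1 (hℓ N).2 (fun p => (hgr 0 p).1) (fun x => hD _ (hcl t) x)
      (gflow (Φ N) t z) (ψ := ψ₁ t)
    have e2 := fun k => abs_integral_growth_le (hℓ N).1 (hℓ N).2 (fun p => (hgr k p).2)
      (fun x => (PiLp.norm_apply_le (ψ₂ t x) k).trans (hGs _ (hcl t) x)) (gflow (Φ N) t z) (ψ := fun x => ψ₂ t x k)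
    set W := ((N : ℝ) + 1)⁻¹ * ∑ i, ‖(gflow (Φ N) t z i).2‖ ^ 2
    have hW0 : 0 ≤ W := by positivity
    refine (abs_add_le _ _).trans ?_
    rw [abs_mul, abs_of_pos hM]
    have h3 : |∑ k, max |a| |b| * ∫ x, momG σ η₁ a b k (fields (ℓ N) (gflow (Φ N) t z) x) * ψ₂ t x k| ≤
        ∑ k : Fin 3, max |a| |b| * (3 / 2 * Gs + Gs / 2 * W) :=
      (Finset.abs_sum_le_sum_abs _ _).trans (Finset.sum_le_sum fun k _ => by
        rw [abs_mul, abs_of_pos hM]; exact mul_le_mul_of_nonneg_left (e2 k) hM.le)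
    rw [Finset.sum_const, Finset.card_univ, Fintype.card_fin, nsmul_eq_mul, Nat.cast_ofNat] at h3
    have e1' := mul_le_mul_of_nonneg_left e1 hM.le
    linarith
  -- joint measurability of the bulk in `(t, z)`
  have hgm : ∀ N, Measurable fun p : ℝ × Config (N + 1) (Fin 3) T3 => g N p.1 p.2 := fun N => by
    have hm₁ : Measurable fun q : ℝ × T3 => ψ₁ q.1 q.2 :=
      EABirthS1a.measurable_clampTime (hφ.timeDerivWithin hS).continuousOn_stLift hτ.1 hIcc
    have hm₂ : Measurable fun q : ℝ × T3 => ψ₂ q.1 q.2 :=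
      EABirthS1a.measurable_clampTime (u := fun s => Torus.gradient (φ s)) (hφ.gradient hS).continuousOn_stLift hτ.1 hIcc
    have h3 := EABirthS1a.measurable_statBulk (EABirthS1a.measurable_statEntropy (N := N) hcont hσ.le hη₁.le hη₁c
      (hℓ N).1.le a b) hm₁ hm₂
    exact ((h3.comp ((measurable_fst.comp measurable_fst).prodMk ((measurable_gflow (Φ N)).comp measurable_fst)
      |>.prodMk measurable_snd)).stronglyMeasurable.integral_prod_right').measurable
  -- concentration of the bulk at each fixed `t ∈ (0, τ]`
  have hconc : ∀ t ∈ Ioc 0 τ, Tendsto (fun N : ℕ => ∫⁻ z, ENNReal.ofReal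
      |g N t z - ∫ z', g N t z' ∂(localGibbsLaw σ a₀ u₀ θ₀ N (Φ N))| ∂(localGibbsLaw σ a₀ u₀ θ₀ N (Φ N)))
      atTop (𝓝 0) := by
    intro t ht
    have ht' : t ∈ Ico 0 T := ⟨ht.1.le, ht.2.trans_lt hτ.2⟩
    have c1 := cD t ht' (ψ₁ t) (hψ₁c t)
    have c2 := fun k => cM t ht' k (fun x => ψ₂ t x k) (hψ₂c t k)
    have h := tendsto_conc_add (fun N => localGibbsLaw σ a₀ u₀ θ₀ N (Φ N))
      (fun N => (c1.1 N).const_mul (max |a| |b|))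
      (fun N => integrable_finsetSum _ fun k _ => ((c2 k).1 N).const_mul (max |a| |b|))
      (tendsto_conc_const_mul _ _ c1.2)
      (tendsto_conc_finsetSum _ Finset.univ (fun k _ N => ((c2 k).1 N).const_mul (max |a| |b|))
        fun k _ => tendsto_conc_const_mul _ _ (c2 k).2)
    refine h.congr fun N => ?_
    simp only [hg_eq]
  -- the time integral concentrates
  obtain ⟨hint, hbulk⟩ := tendsto_conc_integral (fun N => localGibbsLaw σ a₀ u₀ θ₀ N (Φ N)) hP
    (volume.restrict (Ioc 0 τ)) (g := g) hgm (fun N => by fun_prop) (fun N z => by positivity) hWK'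
    (by positivity) (by positivity) hK hbd (ae_restrict_of_forall_mem measurableSet_Ioc hconc)
  -- the boundary term
  have cB := cD τ ⟨hτ.1, hτ.2⟩ (φ τ) hφτ
  have hk_eq : ∀ N z, ∫ x, statBdry σ η₁ (ℓ N) a b (φ τ) (gflow (Φ N) τ z) x =
      max |a| |b| * ∫ x, densG σ η₁ a b (fields (ℓ N) (gflow (Φ N) τ z) x) * φ τ x := fun N z => by
    simp only [statBdry_eq hab (hℓ N).1.le (σ := σ) (η₁ := η₁), integral_const_mul]
  have hbdry := tendsto_conc_const_mul _ (-max |a| |b|) cB.2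
  -- assembly: `A_N = ∫ g_N dt + (−k_N)` almost surely
  have hfin := tendsto_conc_add (fun N => localGibbsLaw σ a₀ u₀ θ₀ N (Φ N)) hint
    (fun N => (cB.1 N).const_mul (-max |a| |b|)) hbulk hbdry
  refine tendsto_conc_congr_ae (fun N => localGibbsLaw σ a₀ u₀ θ₀ N (Φ N)) (fun N => ?_) hfin
  filter_upwards [gflow_ae_eq (Φ N) (hgood N)] with z hz
  rw [EABirthS1a.dynPart_eq_clamp]
  simp only [← hz, hk_eq, hg, neg_mul, ← sub_eq_add_neg]
  rfl

end Summit.AtomisticToContinuum.HydrodynamicLimit.Theorems.EABirthS2bG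

end
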